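import Mathlib.RingTheory.RegularLocalRing.Defs
import Mathlib.RingTheory.DedekindDomain.Ideal.Lemmas
import HarnessLib

/-!
# Overrings of a Dedekind domain inside `C[1/a]` are regular (`stub_oneShotCurvesDedekind`)

Support file for crux stmt-ResolutionOfSingularities-15960 (`SectionAscent.FibrewiseClosedPoints`),
line `registered`, stub `stub_oneShotCurves` (one-shot resolution of affine curves by blowing up
the conductor): the pure commutative algebra behind the regularity of the charts `A[𝔣/a]` of the
blowing up of the conductor `𝔣` — they satisfy `Ã ⊆ A[𝔣/a] ⊆ Ã[1/a]` with `Ã` the (Dedekind)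
normalisation — and behind the regularity of `A_𝔭` for `𝔭 ⊉ 𝔣`.

* `exists_mul_eq_of_dedekind` — if `φ : C → B` is injective, `C` Dedekind, `B` a domain,
  `φ(a)ⁿ z = φ(x)` with `a ≠ 0`, and `Q` is a prime of `B`, then `φ(t) z = φ(y)` with `φ(t) ∉ Q`
  (the ideal `(aⁿ, x)` of `C` is invertible);
* `isRegularLocalRing_of_dedekind` — a local domain all of whose elements are fractions `φ(y)/φ(t)`,
  `φ(t)` a unit, over a Dedekind domain `C` is a localization of `C` at a prime, hence regular
  (Mathlib: Dedekind domains are regular rings, `IsRegularRing`);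
* `isRegularLocalRing_localization_of_dedekind`, `isRegularRing_of_dedekind`,
  `stub_oneShotCurvesDedekind` — a (Noetherian) domain `B` with `C ⊆ B ⊆ C[1/a]` has regular local
  rings (is a regular ring);
* `exists_ringHom_of_le_range` — bookkeeping: factoring a subalgebra through an injective ring map.

References: O. Zariski, P. Samuel, *Commutative Algebra* I, Ch. V §6 (Dedekind domains: every
nonzero ideal is invertible; overrings); everything here is folklore. No definitions are introduced.
-/

-- single-problem summit: the doubled namespace component is forced
set_option linter.dupNamespace false

noncomputable section

namespace Summit.ResolutionOfSingularities.ResolutionOfSingularities.Theorems.SectionAscent.OneShotCurves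

open IsLocalRing

/-- **Fractions over a Dedekind domain clear against any prime.** Let `φ : C → B` be an injective
ring map from a Dedekind domain to a domain, `0 ≠ a ∈ C`, `Q` a prime of `B`, and `z ∈ B` with
`φ(a)ⁿ z = φ(x)`. Then `φ(t) z = φ(y)` for some `t, y ∈ C` with `φ(t) ∉ Q`. Proof: in `C` the ideal
`(aⁿ, x) ∋ aⁿ` divides `(aⁿ)`, say `(aⁿ) = (aⁿ, x) J'`; writing `aⁿ = aⁿ w + x w'` with
`w, w' ∈ J'` one has `x w = c₁ aⁿ`, `x w' = c₂ aⁿ`, `w + c₂ = 1`, and either `t = w, y = c₁`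
(if `φ w ∉ Q`) or `t = w', y = c₂` (if `φ c₂ ∉ Q`, as `φ c₂ = φ(w') z`) works. [folklore] -/
theorem exists_mul_eq_of_dedekind {C B : Type*} [CommRing C] [IsDedekindDomain C] [CommRing B]
    [IsDomain B] (φ : C →+* B) (hφ : Function.Injective φ) {a : C} (ha : a ≠ 0)
    (Q : Ideal B) [Q.IsPrime] (z : B) (hz : ∃ (n : ℕ) (x : C), φ a ^ n * z = φ x) :
    ∃ t y : C, φ t ∉ Q ∧ φ t * z = φ y := by
  obtain ⟨n, x, hx⟩ := hz
  rw [← map_pow] at hx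
  have ha' : a ^ n ≠ 0 := pow_ne_zero n ha
  have hφa : φ (a ^ n) ≠ 0 := (map_ne_zero_iff φ hφ).mpr ha'
  have hle : Ideal.span {a ^ n} ≤ Ideal.span {a ^ n, x} :=
    Ideal.span_mono (Set.singleton_subset_iff.mpr (Set.mem_insert _ _))
  obtain ⟨J', hJ'⟩ := Ideal.dvd_iff_le.mpr hle
  have hxJ : x ∈ Ideal.span {a ^ n, x} := Ideal.subset_span (Set.mem_insert_of_mem _ rfl)
  have key : ∀ u ∈ Ideal.span {a ^ n, x} * J', ∃ w ∈ J', ∃ w' ∈ J', u = a ^ n * w + x * w' := by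
    intro u hu
    refine Submodule.mul_induction_on hu (fun m hm j hj => ?_) (fun u₁ u₂ h₁ h₂ => ?_)
    · obtain ⟨α, β, rfl⟩ := Ideal.mem_span_pair.mp hm
      exact ⟨α * j, J'.mul_mem_left α hj, β * j, J'.mul_mem_left β hj, by ring⟩
    · obtain ⟨w₁, hw₁, w₁', hw₁', rfl⟩ := h₁
      obtain ⟨w₂, hw₂, w₂', hw₂', rfl⟩ := h₂
      exact ⟨w₁ + w₂, J'.add_mem hw₁ hw₂, w₁' + w₂', J'.add_mem hw₁' hw₂', by ring⟩
  have hmem : a ^ n ∈ Ideal.span {a ^ n, x} * J' := hJ' ▸ Ideal.mem_span_singleton_self _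
  obtain ⟨w, hw, w', hw', hdec⟩ := key _ hmem
  obtain ⟨c₁, hc₁⟩ : ∃ c₁, c₁ * a ^ n = x * w :=
    Ideal.mem_span_singleton'.mp (hJ' ▸ Ideal.mul_mem_mul hxJ hw)
  obtain ⟨c₂, hc₂⟩ : ∃ c₂, c₂ * a ^ n = x * w' :=
    Ideal.mem_span_singleton'.mp (hJ' ▸ Ideal.mul_mem_mul hxJ hw')
  have hsum : w + c₂ = 1 := by
    refine mul_left_cancel₀ ha' ?_
    linear_combination -hdec + hc₂
  have hB : φ w + φ c₂ = 1 := by rw [← map_add, hsum, map_one]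
  by_cases hwQ : φ w ∈ Q
  · have hc₂Q : φ c₂ ∉ Q := fun h =>
      Q.ne_top_iff_one.mp (Ideal.IsPrime.ne_top ‹_›) (hB ▸ Q.add_mem hwQ h)
    have hrel : φ w' * z = φ c₂ := by
      refine mul_left_cancel₀ hφa ?_
      rw [← map_mul, mul_comm (a ^ n) c₂, hc₂, map_mul, ← hx]
      ring
    refine ⟨w', c₂, fun h => hc₂Q ?_, hrel⟩
    rw [← hrel]
    exact Q.mul_mem_right _ h
  · refine ⟨w, c₁, hwQ, ?_⟩
    refine mul_left_cancel₀ hφa ?_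
    rw [← map_mul, mul_comm (a ^ n) c₁, hc₁, map_mul, ← hx]
    ring

/-- **A local domain which is a ring of fractions of a Dedekind domain is regular**: if `φ : C → B`
is injective from a Dedekind domain to a local domain and every `z ∈ B` satisfies `φ(t) z = φ(y)`
with `φ(t)` a unit, then `B` is the localization of `C` at the prime `φ⁻¹(𝔪_B)`, a discrete
valuation ring or a field (Mathlib: Dedekind domains are regular rings), so `B` is a regular local
ring. [folklore] -/
theorem isRegularLocalRing_of_dedekind {C B : Type*} [CommRing C] [IsDedekindDomain C]
    [CommRing B] [IsLocalRing B] [IsDomain B] (φ : C →+* B) (hφ : Function.Injective φ)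
    (hsurj : ∀ z : B, ∃ t y : C, IsUnit (φ t) ∧ φ t * z = φ y) : IsRegularLocalRing B := by
  letI := φ.toAlgebra
  haveI : IsLocalization.AtPrime B ((maximalIdeal B).comap φ) := by
    refine (isLocalization_iff _ _).mpr ⟨?_, ?_, ?_⟩
    · rintro ⟨t, ht⟩
      change IsUnit (φ t)
      by_contra h
      exact ht ((mem_maximalIdeal _).mpr h)
    · intro z
      obtain ⟨t, y, hu, he⟩ := hsurj z
      refine ⟨⟨y, ⟨t, fun h => (mem_maximalIdeal _).mp h hu⟩⟩, ?_⟩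
      change z * φ t = φ y
      rw [mul_comm]; exact he
    · intro y₁ y₂ h
      exact ⟨1, by rw [hφ h]⟩
  exact IsRegularLocalRing.of_ringEquiv
    (IsLocalization.algEquiv ((maximalIdeal B).comap φ).primeCompl
      (Localization.AtPrime ((maximalIdeal B).comap φ)) B).toRingEquiv

/-- **Local rings of an overring of a Dedekind domain inside `C[1/a]` are regular**: if
`φ : C → B` is injective from a Dedekind domain to a domain and `B ⊆ φ(C)[1/φ(a)]` (every `z ∈ B`
has `φ(a)ⁿ z ∈ φ(C)`), `a ≠ 0`, then `B_Q` is a regular local ring for every prime `Q` of `B`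
(it is the local ring of `C` at `φ⁻¹(Q)`, by `exists_mul_eq_of_dedekind`). [folklore] -/
theorem isRegularLocalRing_localization_of_dedekind {C B : Type*} [CommRing C]
    [IsDedekindDomain C] [CommRing B] [IsDomain B] (φ : C →+* B) (hφ : Function.Injective φ)
    {a : C} (ha : a ≠ 0) (hB : ∀ z : B, ∃ (n : ℕ) (x : C), φ a ^ n * z = φ x)
    (Q : Ideal B) [Q.IsPrime] : IsRegularLocalRing (Localization.AtPrime Q) := by
  have hinj : Function.Injective (algebraMap B (Localization.AtPrime Q)) :=
    IsLocalization.injective (Localization.AtPrime Q) Q.primeCompl_le_nonZeroDivisors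
  refine isRegularLocalRing_of_dedekind ((algebraMap B (Localization.AtPrime Q)).comp φ)
    (hinj.comp hφ) fun w => ?_
  obtain ⟨⟨b, s⟩, hw⟩ := IsLocalization.surj Q.primeCompl w
  obtain ⟨t, y, ht, hty⟩ := exists_mul_eq_of_dedekind φ hφ ha Q b (hB b)
  obtain ⟨t', y', ht', hty'⟩ := exists_mul_eq_of_dedekind φ hφ ha Q s.1 (hB s.1)
  have hy' : φ y' ∉ Q := by
    rw [← hty']
    exact fun h => ((Ideal.IsPrime.mem_or_mem ‹_› h).elim ht' s.2)
  refine ⟨t * y', y * t', ?_, ?_⟩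
  · rw [RingHom.comp_apply, map_mul, map_mul]
    exact (IsLocalization.map_units _ (⟨φ t, ht⟩ : Q.primeCompl)).mul
      (IsLocalization.map_units _ (⟨φ y', hy'⟩ : Q.primeCompl))
  · simp only [RingHom.comp_apply]
    have e1 : algebraMap B (Localization.AtPrime Q) (φ (t * y')) * w =
        algebraMap B _ (φ t * φ t') * (w * algebraMap B _ s.1) := by
      rw [map_mul φ, ← hty', map_mul (algebraMap B _), map_mul (algebraMap B _),
        map_mul (algebraMap B _)]
      ring
    rw [e1, hw, ← map_mul, map_mul φ, ← hty]
    congr 1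
    ring

/-- Hence a **Noetherian** domain `B` with `C ⊆ B ⊆ C[1/a]`, `C` Dedekind, is a regular ring
(Mathlib `IsRegularRing`: Noetherian with regular local rings). [folklore] -/
theorem isRegularRing_of_dedekind {C B : Type*} [CommRing C] [IsDedekindDomain C] [CommRing B]
    [IsDomain B] [IsNoetherianRing B] (φ : C →+* B) (hφ : Function.Injective φ) {a : C}
    (ha : a ≠ 0) (hB : ∀ z : B, ∃ (n : ℕ) (x : C), φ a ^ n * z = φ x) : IsRegularRing B :=
  isRegularRing_iff.mpr fun Q _ => isRegularLocalRing_localization_of_dedekind φ hφ ha hB Q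

/-- A subalgebra contained in the image of an injective ring map `ψ : B → F` maps back into `B`
by an injective ring map `φ` with `ψ ∘ φ` the inclusion. [folklore] -/
theorem exists_ringHom_of_le_range {B F R : Type*} [CommRing B] [CommRing F] [CommRing R]
    [Algebra R F] (ψ : B →+* F) (hψ : Function.Injective ψ) (S : Subalgebra R F)
    (hS : ∀ s ∈ S, ∃ z, ψ z = s) :
    ∃ φ : S →+* B, Function.Injective φ ∧ ∀ s, ψ (φ s) = s := by
  choose g hg using fun s : S => hS s.1 s.2
  let φ : S →+* B :=
    { toFun := g
      map_one' := hψ (by rw [hg, map_one]; rfl)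
      map_mul' := fun s t => hψ (by rw [hg, map_mul, hg, hg]; rfl)
      map_zero' := hψ (by rw [hg, map_zero]; rfl)
      map_add' := fun s t => hψ (by rw [hg, map_add, hg, hg]; rfl) }
  refine ⟨φ, ?_, hg⟩
  intro s t h
  apply Subtype.ext
  rw [← hg s, ← hg t]
  exact congrArg ψ h

/-- **Registered form** (`stub_oneShotCurvesDedekind`): a Noetherian domain `B` receiving an
injective map `φ` from a Dedekind domain `C` with `B ⊆ φ(C)[1/φ(a)]`, `a ≠ 0`, is a regular ring —
see `isRegularRing_of_dedekind`. [folklore] -/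
theorem stub_oneShotCurvesDedekind (C B : Type) [CommRing C] [IsDedekindDomain C] [CommRing B] [IsDomain B] [IsNoetherianRing B] (φ : C →+* B) (hφ : Function.Injective φ) (a : C) (ha : a ≠ 0) (hB : ∀ z : B, ∃ (n : ℕ) (x : C), φ a ^ n * z = φ x) : IsRegularRing B :=
  isRegularRing_of_dedekind φ hφ ha hB

end Summit.ResolutionOfSingularities.ResolutionOfSingularities.Theorems.SectionAscent.OneShotCurves

end
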